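import Literature.AlgebraicGeometry.Motives.OsculatingLineFamilyCycle
import Literature.AlgebraicGeometry.Motives.PlanesGenerateChowTwoOfCubic
import Literature.AlgebraicGeometry.Motives.HypersurfaceGysinDegree
import Literature.AlgebraicGeometry.Motives.CartierDivisorProjectionFormulaCycle
import Literature.AlgebraicGeometry.Motives.CyclesBirationalLiftFst
import HarnessLib

/-!
# The osculating-line relation `3 [S] ≡ a · H^{d-2} + (planes)` over a surface base (Mboro, Thm. 1.2, Cases 1 and 2)

R. Mboro, *Remarks on the `CH₂` of cubic hypersurfaces* (arXiv:1701.04488), proof of Thm. 1.2,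
Case 2 (p. 7): for the family `f : ℙ_Σ̃ → ℙⁿ⁺¹` of osculating lines over a surface,
"`(f_* ℙ_Σ̃)|_X = d Σ + R` in `CH_r(X)`, where the residual cycle `R` is supported on the image of
`ℙ_{Σ̃₁}`" together with "`d H_X · f_*(1) = i_X^* i_{X,*} f_*(1) ∈ ℤ · H_X^{n-r}`" (p. 7, Case 1).

This file proves the cycle-level relation on the cubic hypersurface `X = V₊(F) ⊆ ℙᵈ⁺¹_k`
(`k` algebraically closed, `d ≥ 14`) for the family of lines over an integral proper surface base
`T` whose generic line is a `k(T)`-line `l = [x][y]` osculating `V₊(F)` at `[x]` and not on it, and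
whose Plücker point is the generic point of a morphism `T → ℙ^𝐍`:

* `ProjFamily.exists_relation_of_osculating_line_over_T` (Case 2 of the printed proof) — **there
  are `a ∈ ℤ` and a cycle `Pl` on `X` supported on PLANE points with
  `3 · (pr₁₊[closure ι([x])])|_X - a · (V₊(ℓ_c)|_X ⋯ V₊(ℓ₁)|_X · [X]) - Pl ∈ Rat₂(X)`;**
* `ProjFamily.exists_relation_of_line_in_X_over_T` (Case 1) — the same conclusion when the line
  `[x][y]` lies on `X_{k(T)}` ("`Σ = H_X · f_*(1) + P_*(…)`" and
  "`d H_X · f_*(1) = i_X^* i_{X,*} f_*(1)`": the hyperplane section of the swept threefold,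
  `exists_primeInter_pullbackFormDivisor_line_eq_of_linear`, the relation `[x] ∼ [p]` between two
  sections spread over `T`, `exists_relation_of_line_over_T` of
  `Motives/PlanesGenerateChowTwoOfCubic`, and `pr₁^*V₊(F) ∼ 3 pr₁^*V₊(ν)`, Fulton Prop. 2.3 (b));
* the two common steps `ProjFamily.exists_planes_restrictMapFst_of_vertical` (vertical components
  push forward to planes) and `ProjFamily.exists_restrictMapFst_primeInter_sub_mem`
  (`(pr₁₊(pr₁^*V₊(F) · [W♯]))|_X ≡ a · [X ∩ M]`).

Proof of Case 2, following the printed one with the tree's renderings: `pr₁^*V₊(F) · [closure ι(l)] =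
3 [closure ι([x])] + V` on `ℙᵈ⁺¹ ×ₖ T` (`Motives/OsculatingLineFamilyCycle`); the projection
formula `pr₁₊(pr₁^*V₊(F) · [W♯]) ≡ V₊(F) · pr₁₊[W♯]` in `Rat₂(ℙᵈ⁺¹; V₊(F))` (Fulton Prop. 2.3 (c),
`Motives/CartierDivisorProjectionFormulaCycle`), restricted to `X`
(`cycleRestrictClosed_mem_ratTrivial_of_mem_ratTrivialOn`); the Gysin pull-back of the `3`-cycle
`pr₁₊[W♯]` of `ℙᵈ⁺¹` is `a · [X ∩ M]` up to `Rat₂(X)` (`i_X^*(CH₃(ℙᵈ⁺¹)) ⊆ ℤ · H_X^{d-2}`,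
`Motives/HypersurfaceGysinDegree`); and every vertical component `w` of `V` (over a proper closed
subset of `T`, on `pr₁⁻¹V₊(F) = X ×ₖ T`) pushes forward to a sum of planes modulo `Rat₂(X)`
(`exists_planes_of_vertical'`, the argument of `Motives/PlanesGenerateChowTwoOfCubic`: `w` lies
over a curve of `T` and sweeps a family of lines over it, `Motives/VerticalSurfacePlanes`; this
replaces Mboro's "`R` is a cycle in the image of `P_*`" and is where `d ≥ 14` is used).

Everything is proved; no named facts.

## References

* [Mboro2018] R. Mboro, Remarks on the CH₂ of cubic hypersurfaces, arXiv:1701.04488, proof of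
  Thm. 1.2 (p. 7).
* [Fulton1998] W. Fulton, Intersection Theory, 2nd ed. (1998), Prop. 2.3 (c), Cor. 2.4.1,
  Example 1.9.3.
* [TianZong2014] Z. Tian, H. R. Zong, One-cycles on rationally connected varieties, Compositio
  Math. 150 (2014), Prop. 7.2 (proof).
-/

noncomputable section

open CategoryTheory CategoryTheory.Limits AlgebraicGeometry MonoidalCategory MvPolynomial
  TopologicalSpace Order Topology
open Literature.AlgebraicGeometry.Motives.Segre Literature.AlgebraicGeometry.Motives.RatFn

universe u

namespace Literature.AlgebraicGeometry.Motives

attribute [local instance] MvPolynomial.gradedAlgebra MvPolynomial.algebraMvPolynomial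
  Literature.AlgebraicGeometry.Motives.ProjBaseChange.algebraBase
  UniversalHyperplaneSection.sectionsAlgebra ProjFamily.functionFieldAlgebra

namespace ProjFamily

open ProjBaseChangeRing ProjectiveSpaceCells ProjectiveSpace FanoScheme ProjSpace
  Literature.RingTheory.MvPolynomial Literature.FieldTheory.QuasiAlgClosed

variable {k : Type u} [Field k]

/-! ### Base change of a proper base -/

section Instances

variable (Y T : SchemeOver k) [IsProper T.hom]

/-- `pr₁ : Y ×ₖ T → Y` is quasi-compact for `T` proper (base change). [folklore] -/
instance quasiCompact_fst_left : QuasiCompact (CartesianMonoidalCategory.fst Y T).left :=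
  inferInstanceAs (QuasiCompact (pullback.fst Y.hom T.hom))

/-- `pr₁ : Y ×ₖ T → Y` is proper for `T` proper (base change). [folklore] -/
instance isProper_fst_left : IsProper (CartesianMonoidalCategory.fst Y T).left :=
  inferInstanceAs (IsProper (pullback.fst Y.hom T.hom))

end Instances

/-! ### Vertical components on `X ×ₖ T` in the closure of a line of `ℙᵈ⁺¹_{k(T)}` -/

section Vertical

variable [IsAlgClosed k] {d : ℕ} (T : SchemeOver k) [IsIntegral T.left] [IsProper T.hom]
  (X : SchemeOver k) (i : X ⟶ projectiveSpace (d + 1) k) [IsClosedImmersion i.left]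
  {F : MvPolynomial (Fin (d + 1 + 1)) k}

/-- **Vertical components over the surface base are sums of planes** (variant of
`ProjFamily.exists_planes_of_vertical` for a line of `ℙᵈ⁺¹_{k(T)}` not necessarily on `X`): for an
integral proper base `T` with generic point of dimension `2`, a `k`-morphism `f : T → ℙ^𝐍` whose
generic point is the Plücker point `[x ∧ y]` of the `k(T)`-line `V₊(μ) = [x][y]`, and a point
`z ∈ X ×ₖ T` of dimension `2`, not over the generic point, whose image in `ℙᵈ⁺¹ ×ₖ T` lies in the
closure of the generic point `ι(V₊(μ))` of the line: `pr₁₊[z]` is rationally equivalent on `X` to an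
integral combination of planes (`pr₂ z` is a curve point and `z` sweeps a family of lines of `X` over
that curve; `d ≥ 14`). [cite: TianZong2014, Prop. 7.2 (proof)] [cite: Mboro2018, proof of Thm. 1.2 (p. 7)] -/
theorem exists_planes_of_vertical' (hd : 14 ≤ d) (hF3 : F.IsHomogeneous 3)
    (hrange : Set.range i.left.base =
      ProjectiveSpectrum.zeroLocus (homogeneousSubmodule (Fin (d + 1 + 1)) k) {F})
    (hT2 : height (genericPoint T.left) = 2)
    (f : T ⟶ projectiveSpace ((d + 1) * (d + 1) + 2 * (d + 1)) k)
    (x y : Fin (d + 1 + 1) → T.left.functionField)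
    (P : Fin ((d + 1) * (d + 1) + 2 * (d + 1) + 1) → T.left.functionField)
    (hPw : ∀ a b, P (plIdx (d + 1) (a, b)) = wedge x y a b) (hP0 : P ≠ 0)
    (hP : qgen T ≫ f.left = (pointOfVec k P hP0).left)
    {μ : Fin (d + 1 - 1) → MvPolynomial (Fin (d + 1 + 1)) T.left.functionField}
    (hμli : LinearIndependent T.left.functionField μ) (hμhom : ∀ l, (μ l).IsHomogeneous 1)
    (hμideal : ∀ G : MvPolynomial (Fin (d + 1 + 1)) T.left.functionField,
      (∀ s t : T.left.functionField, eval (s • x + t • y) G = 0) → G ∈ Ideal.span (Set.range μ))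
    {z : ↥(X ⊗ T).left} (hz2 : height z = 2)
    (hzη : (CartesianMonoidalCategory.snd X T).left.base z ≠ genericPoint T.left)
    (hwS : (i ▷ T).left.base z ∈
      closure {(genericFibreι (d + 1) T).base (linearSubspacePoint μ hμli hμhom (Nat.sub_le (d + 1) 1))}) :
    ∃ (s : Finset ↥X.left) (w : ↥X.left → ℤ), (∀ y' ∈ s, IsLinearSubspacePoint 2 (d + 1) i y') ∧
      IsRationallyEquivalent
        (AlgebraicCycle.map (CartesianMonoidalCategory.fst X T).left height height (primeCycle z))
        (∑ y' ∈ s, w y' • primeCycle y') 2 := by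
  classical
  -- an affine neighbourhood of `b = pr₂ z`, and `b` as a point of it
  obtain ⟨_, ⟨U, hU, rfl⟩, hbU, -⟩ := T.left.isBasis_affineOpens.exists_subset_of_mem_open
    (Set.mem_univ ((CartesianMonoidalCategory.snd X T).left.base z)) isOpen_univ
  obtain ⟨x', hx'⟩ : ∃ x' : U, (x' : T.left) = (CartesianMonoidalCategory.snd X T).left.base z :=
    ⟨⟨_, hbU⟩, rfl⟩
  set j := (i ▷ T).left with hj
  set lam := linearSubspacePoint μ hμli hμhom (Nat.sub_le (d + 1) 1) with hlam
  -- `w = (i × T) z` has dimension `2` and lies over `b`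
  have hw2 : height (j.base z) = 2 := by rw [height_base_eq_of_isClosedImmersion' j z, hz2]
  have hwb : (CartesianMonoidalCategory.snd (projectiveSpace (d + 1) k) T).left.base (j.base z) =
      (x' : T.left) := by
    change (((i ▷ T).left ≫ (CartesianMonoidalCategory.snd (projectiveSpace (d + 1) k) T).left).base z) = _
    rw [whiskerRight_left_snd, hx']
  -- `dim b < 2`
  have hblt : height (x' : T.left) < 2 := by
    rw [← hT2]
    have hle : (x' : T.left) ≤ genericPoint T.left :=
      Scheme.le_iff_specializes.mpr (genericPoint_specializes _)
    have hlt : (x' : T.left) < genericPoint T.left := lt_of_le_not_ge hle fun hge =>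
      (hx' ▸ hzη) ((Scheme.le_iff_specializes.mp hge).antisymm (genericPoint_specializes _)).eq
    exact height_strictMono hlt (lt_of_le_of_lt (height_mono hlt.le) (by rw [hT2]; exact ENat.coe_lt_top 2))
  -- integral line forms at `b`
  obtain ⟨wv, hliO, hvan⟩ := exists_integralLineForms_of_pluecker (N := d + 1) (by omega) T f x y P
    hPw hP0 hP (x' : T.left)
  have hlamI : (ProjectiveSpectrum.asHomogeneousIdeal
      (𝒜 := homogeneousSubmodule (Fin (d + 1 + 1)) T.left.functionField) lam).toIdeal =
        Ideal.span (Set.range μ) := toIdeal_linearSubspacePoint μ hμli hμhom _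
  have hwmem : ∀ l, lin (Literature.LinearAlgebra.toFrac (T.left.presheaf.stalk (x' : T.left))
      T.left.functionField (wv l)) ∈
      ProjectiveSpectrum.asHomogeneousIdeal
        (𝒜 := homogeneousSubmodule (Fin (d + 1 + 1)) T.left.functionField) lam := by
    intro l
    change _ ∈ (ProjectiveSpectrum.asHomogeneousIdeal
      (𝒜 := homogeneousSubmodule (Fin (d + 1 + 1)) T.left.functionField) lam).toIdeal
    rw [hlamI]
    refine hμideal _ fun s t => ?_
    rw [eval_lin_eq_sum]
    exact hvan l _ (Submodule.mem_span_pair.mpr ⟨s, t, rfl⟩)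
  -- case `b` closed: impossible
  rcases (show height (x' : T.left) = 0 ∨ height (x' : T.left) = 1 by
      have h2 : height (x' : T.left) ≤ 1 := Order.le_of_lt_add_one (by exact_mod_cast hblt)
      rcases eq_or_lt_of_le h2 with h | h
      · exact Or.inr h
      · exact Or.inl (Order.lt_one_iff.mp h)) with hb0 | hb1
  · exfalso
    have hbcl : IsClosed ({(x' : T.left)} : Set T.left) := isClosed_singleton_of_height_eq_zero' hb0
    obtain ⟨L, hLli, hLhom, hmem, hheq⟩ := exists_forms_of_vertical_of_mem T (genericFibreι (d + 1) T)
      (genericFibreι_fst (d + 1) T) (genericFibreι_snd (d + 1) T) lam hwS hbcl hwb wv hwmem hliO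
    -- `pr₁ w` lies on the line `V₊(L)`, of dimension `≤ 1`, but has dimension `2`
    have hle1 : height ((CartesianMonoidalCategory.fst (projectiveSpace (d + 1) k) T).left.base
        (j.base z)) ≤ 1 := by
      have hd1 : d + 1 - 1 ≤ d + 1 := Nat.sub_le _ _
      by_cases hne : (CartesianMonoidalCategory.fst (projectiveSpace (d + 1) k) T).left.base (j.base z) =
          linearSubspacePoint L hLli hLhom hd1
      · rw [hne, height_linearSubspacePoint, show d + 1 - (d + 1 - 1) = 1 by omega]; rfl
      · have hlt := height_lt_of_mem_zeroLocus L hLli hLhom hd1 hmem hne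
        rw [show d + 1 - (d + 1 - 1) = 1 by omega] at hlt
        exact le_of_lt hlt
    rw [hheq, hw2] at hle1
    exact absurd hle1 (by norm_num)
  · -- `b` is a curve point: the family of lines over the curve
    letI algκ : Algebra Γ(T.left, U) (IsLocalRing.ResidueField (T.left.presheaf.stalk (x' : T.left))) :=
      ((IsLocalRing.residue (T.left.presheaf.stalk (x' : T.left))).comp
        (algebraMap Γ(T.left, U) (T.left.presheaf.stalk (x' : T.left)))).toAlgebra
    haveI : IsScalarTower Γ(T.left, U) (T.left.presheaf.stalk (x' : T.left))
        (IsLocalRing.ResidueField (T.left.presheaf.stalk (x' : T.left))) :=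
      IsScalarTower.of_algebraMap_eq fun _ => rfl
    have hfin : height (x' : T.left) ≠ ⊤ := by rw [hb1]; exact ENat.coe_ne_top 1
    have hheight : height (j.base z) = height (x' : T.left) + 1 := by rw [hw2, hb1]; rfl
    obtain ⟨hLli, hσ⟩ := exists_fibre_linePoint_of_vertical_of_mem (d + 1) T hU x' (by omega)
      (genericFibreι (d + 1) T) (genericFibreι_fst (d + 1) T) (genericFibreι_snd (d + 1) T) lam hwS
      hwb hfin hheight wv hwmem hliO
    exact exists_planes_of_vertical_over_curve hd T X i hF3 hrange hU x' hb1 hLli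
      (fun _ => isHomogeneous_lin _) hσ.symm

end Vertical

/-! ### The relation over the surface base, pushed forward to `ℙᵈ⁺¹` and restricted to `X` -/


section Relation

variable [IsAlgClosed k] {d : ℕ} (T : SchemeOver k) [IsIntegral T.left] [IsProper T.hom]
  (X : SchemeOver k) [IsIntegral X.left] [LocallyOfFiniteType X.hom]
  (i : X ⟶ projectiveSpace (d + 1) k) [IsClosedImmersion i.left]
  {F : MvPolynomial (Fin (d + 1 + 1)) k}

/-- `pr₁₊` then restriction to `X`: the additive map `c ↦ (pr₁₊ c)|_X` from cycles on `ℙᵈ⁺¹ ×ₖ T`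
to cycles on `X`. [folklore] -/
def restrictMapFst : AlgebraicCycle ((projectiveSpace (d + 1) k) ⊗ T).left ℤ →+ AlgebraicCycle X.left ℤ :=
  (cycleRestrictClosedHom i.left).comp
    (AddMonoidHom.mk' (AlgebraicCycle.map
      (CartesianMonoidalCategory.fst (projectiveSpace (d + 1) k) T).left height height)
      (algebraicCycleMap_add _ height height))

omit [IsAlgClosed k] [IsIntegral T.left] [IsIntegral X.left] [LocallyOfFiniteType X.hom] in
/-- `restrictMapFst c = (pr₁₊ c)|_X` (`rfl`). [folklore] -/
theorem restrictMapFst_apply (c : AlgebraicCycle ((projectiveSpace (d + 1) k) ⊗ T).left ℤ) :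
    restrictMapFst T X i c = cycleRestrictClosed i.left (AlgebraicCycle.map
      (CartesianMonoidalCategory.fst (projectiveSpace (d + 1) k) T).left height height c) :=
  rfl

omit [IsAlgClosed k] [IsIntegral T.left] [IsIntegral X.left] [LocallyOfFiniteType X.hom] in
/-- **`(pr₁₊[(i × T) z])|_X = pr₁₊[z]`** for `z ∈ X ×ₖ T` (`(i × T) ≫ pr₁ = pr₁ ≫ i`, functoriality
of push-forward, and `restrict ∘ i_* = id`). [folklore] -/
theorem restrictMapFst_primeCycle_whiskerRight (z : ↥(X ⊗ T).left) :
    restrictMapFst T X i (primeCycle ((i ▷ T).left.base z)) =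
      AlgebraicCycle.map (CartesianMonoidalCategory.fst X T).left height height (primeCycle z) := by
  haveI : IsProper (projectiveSpace (d + 1) k).hom := isProper_projectiveSpace (d + 1) k
  haveI : IsProper X.hom := by rw [← Over.w i]; infer_instance
  haveI : IsProper ((i ▷ T).left ≫ (CartesianMonoidalCategory.fst (projectiveSpace (d + 1) k) T).left) :=
    inferInstance
  haveI : IsProper ((CartesianMonoidalCategory.fst X T).left ≫ i.left) := inferInstance
  rw [restrictMapFst_apply, ← algebraicCycleMap_primeCycle (i ▷ T).left z,
    ← algebraicCycleMap_comp (i ▷ T).left _ (i ▷ T).left.isClosedMap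
      (CartesianMonoidalCategory.fst (projectiveSpace (d + 1) k) T).left.isClosedMap]
  have hcongr : ∀ {φ ψ : (X ⊗ T).left ⟶ (projectiveSpace (d + 1) k).left} (_ : QuasiCompact φ)
      (_ : QuasiCompact ψ), φ = ψ → AlgebraicCycle.map φ height height (primeCycle z) =
        AlgebraicCycle.map ψ height height (primeCycle z) := by
    rintro φ ψ _ _ rfl; rfl
  have h : AlgebraicCycle.map ((i ▷ T).left ≫ (CartesianMonoidalCategory.fst (projectiveSpace (d + 1) k) T).left)
      height height (primeCycle z) =
      AlgebraicCycle.map ((CartesianMonoidalCategory.fst X T).left ≫ i.left) height height (primeCycle z) :=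
    hcongr inferInstance inferInstance (whiskerRight_left_fst (d + 1) T X i)
  rw [h, algebraicCycleMap_comp _ _ (CartesianMonoidalCategory.fst X T).left.isClosedMap i.left.isClosedMap,
    cycleRestrictClosed_map]

omit [IsIntegral X.left] [LocallyOfFiniteType X.hom] in
/-- **Vertical components push forward to planes.** For a cycle `V` on `ℙᵈ⁺¹ ×ₖ T` supported on
points `w` of dimension `2` in the closure of the generic point `ι(l)` of the `k(T)`-line
`l = [x][y]` (Plücker point the generic point of `f : T → ℙ^𝐍`), not over `η_T`, and on
`pr₁⁻¹(X)`: `(pr₁₊ V)|_X ≡ Pl` modulo `Rat₂(X)` for a cycle `Pl` supported on plane points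
(`exists_planes_of_vertical'` for each point of the — finite — support).
[cite: TianZong2014, Prop. 7.2 (proof)] [cite: Mboro2018, proof of Thm. 1.2 (p. 7)] -/
theorem exists_planes_restrictMapFst_of_vertical (hd : 14 ≤ d) (hF3 : F.IsHomogeneous 3)
    (hrange : Set.range i.left.base =
      ProjectiveSpectrum.zeroLocus (homogeneousSubmodule (Fin (d + 1 + 1)) k) {F})
    (hT2 : height (genericPoint T.left) = 2)
    (f : T ⟶ projectiveSpace ((d + 1) * (d + 1) + 2 * (d + 1)) k)
    (x y : Fin (d + 1 + 1) → T.left.functionField)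
    (P : Fin ((d + 1) * (d + 1) + 2 * (d + 1) + 1) → T.left.functionField)
    (hPw : ∀ a b, P (plIdx (d + 1) (a, b)) = wedge x y a b) (hP0 : P ≠ 0)
    (hP : qgen T ≫ f.left = (pointOfVec k P hP0).left)
    {μ : Fin (d + 1 - 1) → MvPolynomial (Fin (d + 1 + 1)) T.left.functionField}
    (hμli : LinearIndependent T.left.functionField μ) (hμhom : ∀ l, (μ l).IsHomogeneous 1)
    (hμideal : ∀ G : MvPolynomial (Fin (d + 1 + 1)) T.left.functionField,
      (∀ s t : T.left.functionField, eval (s • x + t • y) G = 0) → G ∈ Ideal.span (Set.range μ))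
    (V : AlgebraicCycle ((projectiveSpace (d + 1) k) ⊗ T).left ℤ)
    (hV : ∀ w', V w' ≠ 0 →
      genericFibreι (d + 1) T (linearSubspacePoint μ hμli hμhom (Nat.sub_le (d + 1) 1)) ⤳ w' ∧
      height w' = (2 : ℕ) ∧
      (CartesianMonoidalCategory.snd (projectiveSpace (d + 1) k) T).left w' ≠ genericPoint T.left ∧
      F ∈ ProjectiveSpectrum.asHomogeneousIdeal (𝒜 := homogeneousSubmodule (Fin (d + 1 + 1)) k)
        ((CartesianMonoidalCategory.fst (projectiveSpace (d + 1) k) T).left w')) :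
    ∃ Pl : AlgebraicCycle X.left ℤ, (∀ y', Pl y' ≠ 0 → IsLinearSubspacePoint 2 (d + 1) i y') ∧
      restrictMapFst T X i V - Pl ∈ ratTrivial X.left 2 := by
  classical
  haveI : IsProper (projectiveSpace (d + 1) k).hom := isProper_projectiveSpace (d + 1) k
  haveI : QuasiCompact ((projectiveSpace (d + 1) k) ⊗ T).hom :=
    inferInstanceAs (QuasiCompact (pullback.fst (projectiveSpace (d + 1) k).hom T.hom ≫
      (projectiveSpace (d + 1) k).hom))
  haveI : CompactSpace ↥((projectiveSpace (d + 1) k) ⊗ T).left :=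
    compactSpace_of_quasiCompact_hom ((projectiveSpace (d + 1) k) ⊗ T)
  let R := restrictMapFst T X i
  have hVpl : ∀ w', V w' ≠ 0 → ∃ Plz : AlgebraicCycle X.left ℤ,
      (∀ y', Plz y' ≠ 0 → IsLinearSubspacePoint 2 (d + 1) i y') ∧
        R (primeCycle w') - Plz ∈ ratTrivial X.left 2 := by
    intro w' hw'
    obtain ⟨hsp, hh2, hη, hFmem⟩ := hV w' hw'
    -- `w'` lies on `X ×ₖ T`
    have hw'X : w' ∈ Set.range (i ▷ T).left.base := by
      rw [range_whiskerRight_left_eq T i, Set.mem_preimage, hrange]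
      intro G hG
      rw [Set.mem_singleton_iff.mp hG]
      exact hFmem
    obtain ⟨z, rfl⟩ := hw'X
    have hz2 : height z = 2 := by
      rw [← height_base_eq_of_isClosedImmersion' (i ▷ T).left z, hh2]; rfl
    have hzη : (CartesianMonoidalCategory.snd X T).left.base z ≠ genericPoint T.left := by
      intro h
      apply hη
      change (((i ▷ T).left ≫ (CartesianMonoidalCategory.snd (projectiveSpace (d + 1) k) T).left).base z) = _
      rw [whiskerRight_left_snd]
      exact h
    have hwS : (i ▷ T).left.base z ∈
        closure {(genericFibreι (d + 1) T).base (linearSubspacePoint μ hμli hμhom (Nat.sub_le (d + 1) 1))} :=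
      specializes_iff_mem_closure.mp hsp
    obtain ⟨s, wt, hs, hrat⟩ := exists_planes_of_vertical' T X i hd hF3 hrange hT2 f x y P hPw hP0 hP
      hμli hμhom hμideal hz2 hzη hwS
    refine ⟨∑ y' ∈ s, wt y' • primeCycle y', fun y' hy' => hs y' ?_, ?_⟩
    · by_contra hys
      apply hy'
      simp only [Function.locallyFinsuppWithin.coe_sum, Finset.sum_apply,
        Function.locallyFinsuppWithin.coe_zsmul, Pi.smul_apply, smul_eq_mul]
      refine Finset.sum_eq_zero fun y'' hy'' => ?_
      have hne : y' ≠ y'' := fun h => hys (h ▸ hy'')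
      rw [primeCycle_apply_of_ne hne, mul_zero]
    · change restrictMapFst T X i (primeCycle ((i ▷ T).left.base z)) - _ ∈ _
      rw [restrictMapFst_primeCycle_whiskerRight]
      exact hrat
  choose! Plz hPlz using hVpl
  let S : Finset ↥((projectiveSpace (d + 1) k) ⊗ T).left := (finite_support_of_compactSpace V).toFinset
  have hSmem : ∀ w', w' ∈ S ↔ V w' ≠ 0 := fun w' => by
    simp only [S, Set.Finite.mem_toFinset, Function.mem_support]
  let Pl : AlgebraicCycle X.left ℤ := ∑ w' ∈ S, V w' • Plz w'
  have hPl : ∀ y', Pl y' ≠ 0 → IsLinearSubspacePoint 2 (d + 1) i y' := by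
    intro y' hy'
    have : ∃ w' ∈ S, (Plz w') y' ≠ 0 := by
      by_contra hnone
      push Not at hnone
      apply hy'
      simp only [Pl, Function.locallyFinsuppWithin.coe_sum, Finset.sum_apply,
        Function.locallyFinsuppWithin.coe_zsmul, Pi.smul_apply, smul_eq_mul]
      exact Finset.sum_eq_zero fun w' hw' => by rw [hnone w' hw', mul_zero]
    obtain ⟨w', hw'S, hw'y⟩ := this
    exact (hPlz w' ((hSmem w').1 hw'S)).1 y' hw'y
  have hVsum : V = ∑ w' ∈ S, V w' • primeCycle w' :=
    eq_sum_smul_primeCycle_of_support_subset V (s := S) (by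
      intro w' hw'; exact Finset.mem_coe.2 ((hSmem w').2 (Function.mem_support.1 hw')))
  refine ⟨Pl, hPl, ?_⟩
  have hdiff : R V - Pl = ∑ w' ∈ S, V w' • (R (primeCycle w') - Plz w') := by
    conv_lhs => rw [hVsum]
    simp only [Pl, map_sum, map_zsmul, ← Finset.sum_sub_distrib, smul_sub]
  change R V - Pl ∈ _
  rw [hdiff]
  exact AddSubgroup.sum_mem _ fun w' hw' => AddSubgroup.zsmul_mem _ (hPlz w' ((hSmem w').1 hw')).2 _

/-- **`(pr₁₊(pr₁^*V₊(F) · [W♯]))|_X ≡ a · [X ∩ M]` in `Rat₂(X)`** for the closure `W♯` of a point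
`w₀` of `ℙᵈ⁺¹ ×ₖ T` of dimension `3`: the projection formula
`pr₁₊(pr₁^*V₊(F) · [W♯]) ≡ V₊(F) · pr₁₊[W♯]` in `Rat₂(ℙᵈ⁺¹; V₊(F))` (Fulton Prop. 2.3 (c)),
restricted to `X = V₊(F)`, and `(V₊(F) · γ)|_X ≡ a · [X ∩ M]` for the `3`-cycle `γ = pr₁₊[W♯]` of
`ℙᵈ⁺¹` (Mboro: "`d H_X · f_*(1) = i_X^* i_{X,*} f_*(1) ∈ ℤ · H_X^{n-r}`").
[cite: Mboro2018, proof of Thm. 1.2 (arXiv:1701.04488, p. 7)] [cite: Fulton1998, Prop. 2.3 (c), Cor. 2.4.1, Example 1.9.3] -/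
theorem exists_restrictMapFst_primeInter_sub_mem
    (hF : F ∈ grading (Fin (d + 1 + 1)) k 3) (hprime : Prime F)
    (hrange : Set.range i.left.base =
      ProjectiveSpectrum.zeroLocus (homogeneousSubmodule (Fin (d + 1 + 1)) k) {F})
    {c : ℕ} (hdim : 2 + c = d) (ℓ : Fin c → MvPolynomial (Fin (d + 1 + 1)) k)
    (hℓ : ∀ j, ℓ j ∈ grading (Fin (d + 1 + 1)) k 1) (hlin : LinearIndependent k ℓ)
    (hav : ∀ j, (formDivisor (ℓ j) (hℓ j) (hlin.ne_zero j)).Avoids (i.left.base (genericPoint ↥X.left)))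
    (w : ↥(projectiveSpace (d + 1) k).left)
    (hw : (ProjectiveSpectrum.asHomogeneousIdeal
      (𝒜 := homogeneousSubmodule (Fin (d + 1 + 1)) k) w).toIdeal = Ideal.span (Set.range ℓ))
    (hFw : F ∉ ProjectiveSpectrum.asHomogeneousIdeal (𝒜 := homogeneousSubmodule (Fin (d + 1 + 1)) k) w)
    {w₀ : ↥((projectiveSpace (d + 1) k) ⊗ T).left} (hw₀ : height w₀ = (2 : ℕ) + 1) :
    ∃ a : ℤ, restrictMapFst T X i ((pullbackFormDivisor (B := T) hF hprime.ne_zero).primeInter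
        (X := (projectiveSpace (d + 1) k) ⊗ T) w₀) -
      a • CartierDivisor.iterInter c
        (fun j => (formDivisor (ℓ j) (hℓ j) (hlin.ne_zero j)).pullbackAvoiding i.left (hav j))
        (primeCycle (genericPoint ↥X.left)) ∈ ratTrivial X.left 2 := by
  classical
  haveI : IsProper (projectiveSpace (d + 1) k).hom := isProper_projectiveSpace (d + 1) k
  have hF0 : F ≠ 0 := hprime.ne_zero
  let fstP := (CartesianMonoidalCategory.fst (projectiveSpace (d + 1) k) T).left
  let D : CartierDivisor (projectiveSpace (d + 1) k).left := formDivisor F hF hF0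
  -- the projection formula along `pr₁`
  have hrep : D.pullbackRep fstP = pullbackFormDivisor (B := T) hF hF0 :=
    CartierDivisor.pullbackRep_of_avoids D fstP (formDivisor_avoids_fst_genericPoint hF hF0)
  have hproj := CartierDivisor.map_primeInter_pullbackRep_sub_smul_mem
    (X' := (projectiveSpace (d + 1) k) ⊗ T) (X := projectiveSpace (d + 1) k)
    (CartesianMonoidalCategory.fst (projectiveSpace (d + 1) k) T) D (z' := w₀) (d := 2) hw₀
  rw [hrep] at hproj
  -- the `3`-cycle `γ = pr₁₊[W♯]` and `D · γ`
  let γ : AlgebraicCycle (projectiveSpace (d + 1) k).left ℤ := AlgebraicCycle.map fstP height height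
    (primeCycle w₀)
  have hγ3 : γ ∈ cyclesOfDim (projectiveSpace (d + 1) k).left (2 + 1) :=
    map_mem_cyclesOfDim fstP (primeCycle_mem_cyclesOfDim hw₀)
  have hDγ : (AlgebraicCycle.mapCoeff fstP height height w₀ : ℤ) • D.primeInter (fstP.base w₀) =
      D.interCycle γ := by
    change _ = D.interCycle (AlgebraicCycle.map fstP height height (primeCycle w₀))
    rw [algebraicCycleMap_primeCycle_eq_nsmul, ← natCast_zsmul, CartierDivisor.interCycle_zsmul,
      CartierDivisor.interCycle_primeCycle]
  rw [hDγ] at hproj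
  -- restrict to `X`
  have hsuppX : closure {fstP.base w₀} ∩ {x | ¬ D.Avoids x} ⊆ Set.range i.left.base := by
    rw [Hypersurface.range_base_eq_setOf_not_avoids i hF hprime hrange]
    exact Set.inter_subset_right
  have hprojX := cycleRestrictClosed_mem_ratTrivial_of_mem_ratTrivialOn i.left
    (ratTrivialOn_mono hsuppX hproj)
  -- the Gysin pull-back of `γ`
  obtain ⟨a, ha⟩ := Hypersurface.exists_isRationallyEquivalent_gysinCycle_zsmul_iterInter i hF hprime
    hrange hdim ℓ hℓ hlin hav w hw hFw γ hγ3
  refine ⟨a, ?_⟩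
  have hgys : CartierDivisor.gysinCycle (X := projectiveSpace (d + 1) k) i.left D γ =
      cycleRestrictClosed i.left (D.interCycle γ) := rfl
  have key : restrictMapFst T X i ((pullbackFormDivisor (B := T) hF hF0).primeInter
        (X := (projectiveSpace (d + 1) k) ⊗ T) w₀) -
      a • CartierDivisor.iterInter c
        (fun j => (formDivisor (ℓ j) (hℓ j) (hlin.ne_zero j)).pullbackAvoiding i.left (hav j))
        (primeCycle (genericPoint ↥X.left)) =
      cycleRestrictClosed i.left (AlgebraicCycle.map fstP height height
        ((pullbackFormDivisor (B := T) hF hF0).primeInter (X := (projectiveSpace (d + 1) k) ⊗ T) w₀) -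
          D.interCycle γ) +
      (CartierDivisor.gysinCycle (X := projectiveSpace (d + 1) k) i.left D γ -
        a • CartierDivisor.iterInter c
          (fun j => (formDivisor (ℓ j) (hℓ j) (hlin.ne_zero j)).pullbackAvoiding i.left (hav j))
          (primeCycle (genericPoint ↥X.left))) := by
    rw [hgys, restrictMapFst_apply, ← cycleRestrictClosedHom_apply, ← cycleRestrictClosedHom_apply,
      ← cycleRestrictClosedHom_apply, map_sub]
    abel
  rw [key]
  exact AddSubgroup.add_mem _ hprojX ha

/-- **Mboro's osculating-line relation over a surface base, on the cubic hypersurface** (proof of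
Thm. 1.2, Case 2, with "`3 H_X · f_*(1) = i_X^* i_{X,*} f_*(1) ∈ ℤ · H_X^{d-2}`"). Let
`X = V₊(F) ⊆ ℙᵈ⁺¹_k` be an integral cubic hypersurface over an algebraically closed field, `d ≥ 14`,
`M = V₊(ℓ₁, …, ℓ_c) ⊄ X` a `3`-plane (`2 + c = d`) whose hyperplanes do not contain `X`, `T` an
integral proper surface base (`dim = 2`) with a morphism `f : T → ℙ^𝐍` whose generic point is the
Plücker point of the `k(T)`-line `[x][y]`, which osculates `V₊(F)` at `[x]`
(`F(s x + t y) = t³ F(y)`) and is not on it (`F(y) ≠ 0`). Then there are `a ∈ ℤ` and a cycle `Pl`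
on `X` supported on plane points with
`3 · (pr₁₊[closure ι([x])])|_X - a · (V₊(ℓ_c)|_X ⋯ V₊(ℓ₁)|_X · [X]) - Pl ∈ Rat₂(X)`.
[cite: Mboro2018, proof of Thm. 1.2, Case 2 (arXiv:1701.04488, p. 7)] [cite: Fulton1998, Prop. 2.3 (c), Cor. 2.4.1, Example 1.9.3] [cite: TianZong2014, Prop. 7.2 (proof)] -/
theorem exists_relation_of_osculating_line_over_T (hd : 14 ≤ d)
    (hF : F ∈ grading (Fin (d + 1 + 1)) k 3) (hprime : Prime F)
    (hrange : Set.range i.left.base =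
      ProjectiveSpectrum.zeroLocus (homogeneousSubmodule (Fin (d + 1 + 1)) k) {F})
    (hT2 : height (genericPoint T.left) = 2)
    {c : ℕ} (hdim : 2 + c = d) (ℓ : Fin c → MvPolynomial (Fin (d + 1 + 1)) k)
    (hℓ : ∀ j, ℓ j ∈ grading (Fin (d + 1 + 1)) k 1) (hlin : LinearIndependent k ℓ)
    (hav : ∀ j, (formDivisor (ℓ j) (hℓ j) (hlin.ne_zero j)).Avoids (i.left.base (genericPoint ↥X.left)))
    (w : ↥(projectiveSpace (d + 1) k).left)
    (hw : (ProjectiveSpectrum.asHomogeneousIdeal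
      (𝒜 := homogeneousSubmodule (Fin (d + 1 + 1)) k) w).toIdeal = Ideal.span (Set.range ℓ))
    (hFw : F ∉ ProjectiveSpectrum.asHomogeneousIdeal (𝒜 := homogeneousSubmodule (Fin (d + 1 + 1)) k) w)
    (f : T ⟶ projectiveSpace ((d + 1) * (d + 1) + 2 * (d + 1)) k)
    (x y : Fin (d + 1 + 1) → T.left.functionField)
    (hxy : LinearIndependent T.left.functionField ![x, y])
    (hosc : ∀ s t : T.left.functionField,
      eval (s • x + t • y) (MvPolynomial.map (algebraMap k T.left.functionField) F) =
        t ^ 3 * eval y (MvPolynomial.map (algebraMap k T.left.functionField) F))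
    (hFy : eval y (MvPolynomial.map (algebraMap k T.left.functionField) F) ≠ 0)
    (P : Fin ((d + 1) * (d + 1) + 2 * (d + 1) + 1) → T.left.functionField)
    (hPw : ∀ a b, P (plIdx (d + 1) (a, b)) = wedge x y a b) (hP0 : P ≠ 0)
    (hP : qgen T ≫ f.left = (pointOfVec k P hP0).left) :
    ∃ (a : ℤ) (Pl : AlgebraicCycle X.left ℤ), (∀ y', Pl y' ≠ 0 → IsLinearSubspacePoint 2 (d + 1) i y') ∧
      3 • restrictMapFst T X i (primeCycle (genericFibreι (d + 1) T
          (pointOfVec T.left.functionField x (by simpa using hxy.ne_zero 0)).pt)) -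
        a • CartierDivisor.iterInter c
          (fun j => (formDivisor (ℓ j) (hℓ j) (hlin.ne_zero j)).pullbackAvoiding i.left (hav j))
          (primeCycle (genericPoint ↥X.left)) - Pl ∈ ratTrivial X.left 2 := by
  classical
  haveI := infinite_functionField (k := k) T
  have hN : 1 ≤ d + 1 := by omega
  have hF0 : F ≠ 0 := hprime.ne_zero
  have hF3 : F.IsHomogeneous 3 := (mem_homogeneousSubmodule 3 F).1 hF
  -- the line forms
  obtain ⟨μ, hμli, hμhom, hμv, hμideal⟩ := exists_lineForms ![x, y] hxy hN
  have hμx : ∀ l, eval x (μ l) = 0 := fun l => hμv l 0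
  have hμy : ∀ l, eval y (μ l) = 0 := fun l => hμv l 1
  have hμideal' : ∀ G : MvPolynomial (Fin (d + 1 + 1)) T.left.functionField,
      (∀ s t : T.left.functionField, eval (s • x + t • y) G = 0) → G ∈ Ideal.span (Set.range μ) :=
    fun G hG => hμideal G fun s t => hG s t
  let R := restrictMapFst T X i
  -- (1) `pr₁^*V₊(F) · [closure ι(l)] = 3 [closure ι([x])] + V`
  obtain ⟨V, hZ, -, hVsupp⟩ := exists_primeInter_pullbackFormDivisor_line_eq (B := T) hN hT2 hxy
    hF hF0 hosc hFy hμli hμhom hμx hμy hμideal'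
  -- (2) the vertical part pushes forward to planes
  obtain ⟨Pl, hPl, hRV⟩ := exists_planes_restrictMapFst_of_vertical T X i hd hF3 hrange hT2 f x y P hPw
    hP0 hP hμli hμhom hμideal' V hVsupp
  -- (3) `(pr₁₊(pr₁^*V₊(F) · [closure ι(l)]))|_X ≡ a · [X ∩ M]`
  have hlam1 : height (linearSubspacePoint μ hμli hμhom (Nat.sub_le (d + 1) 1)) = 1 :=
    height_linearSubspacePoint_of_line hN μ hμli hμhom
  have hιlam : height (genericFibreι (d + 1) T (linearSubspacePoint μ hμli hμhom (Nat.sub_le (d + 1) 1))) =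
      (2 : ℕ) + 1 := by
    rw [height_genericFibreι_apply (d + 1) T hT2, hlam1]
  obtain ⟨a, ha⟩ := exists_restrictMapFst_primeInter_sub_mem T X i hF hprime hrange hdim ℓ hℓ hlin hav
    w hw hFw hιlam
  -- (4) assemble (with the plane cycle `-Pl`)
  refine ⟨a, -Pl, fun y' hy' => hPl y' (by
    rwa [Function.locallyFinsuppWithin.coe_neg, Pi.neg_apply, neg_ne_zero] at hy'), ?_⟩
  have hRZ : R ((pullbackFormDivisor (B := T) hF hF0).primeInter (X := (projectiveSpace (d + 1) k) ⊗ T)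
      (genericFibreι (d + 1) T (linearSubspacePoint μ hμli hμhom (Nat.sub_le (d + 1) 1)))) =
      3 • R (primeCycle (genericFibreι (d + 1) T
        (pointOfVec T.left.functionField x (by simpa using hxy.ne_zero 0)).pt)) + R V := by
    rw [hZ, map_add, map_nsmul]
  have key : 3 • R (primeCycle (genericFibreι (d + 1) T
        (pointOfVec T.left.functionField x (by simpa using hxy.ne_zero 0)).pt)) -
      a • CartierDivisor.iterInter c
        (fun j => (formDivisor (ℓ j) (hℓ j) (hlin.ne_zero j)).pullbackAvoiding i.left (hav j))
        (primeCycle (genericPoint ↥X.left)) - -Pl =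
      (R ((pullbackFormDivisor (B := T) hF hF0).primeInter (X := (projectiveSpace (d + 1) k) ⊗ T)
          (genericFibreι (d + 1) T (linearSubspacePoint μ hμli hμhom (Nat.sub_le (d + 1) 1)))) -
        a • CartierDivisor.iterInter c
          (fun j => (formDivisor (ℓ j) (hℓ j) (hlin.ne_zero j)).pullbackAvoiding i.left (hav j))
          (primeCycle (genericPoint ↥X.left))) - (R V - Pl) := by
    rw [hRZ]; abel
  rw [key]
  exact AddSubgroup.sub_mem _ ha hRV

/-! ### Case 1: the line lies on `X` -/

/-- `x ∧ (a x + b y) = b (x ∧ y)`. [folklore] -/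
theorem wedge_self_add_smul {L : Type u} [Field L] {n : ℕ} (x y : Fin (n + 1) → L) (a b : L) :
    wedge x (a • x + b • y) = b • wedge x y := by
  ext i j
  simp only [wedge, Pi.add_apply, Pi.smul_apply, smul_eq_mul]
  ring

/-- **Mboro's relation over a surface base when the lines lie on `X`** (proof of Thm. 1.2, Case 1:
"`Σ = H_X · f_*(1) + P_*(p_* σ̃_*(D))`" and "`d H_X · f_*(1) = i_X^* i_{X,*} f_*(1) ∈ ℤ · H_X^{n-r}`").
Same setting as `exists_relation_of_osculating_line_over_T`, but with the `k(T)`-line `[x][y]`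
contained in `X_{k(T)}` (`F ≡ 0` on `span(x, y)`). Then again there are `a ∈ ℤ` and a cycle `Pl`
on `X` supported on plane points with
`3 · (pr₁₊[closure ι([x])])|_X - a · (V₊(ℓ_c)|_X ⋯ V₊(ℓ₁)|_X · [X]) - Pl ∈ Rat₂(X)`.
Proof: for a coordinate hyperplane `V₊(ν) ∌ [x]` and the point `p = l ∩ V₊(ν)`, the two sections
`[x]`, `p` of the family differ by planes (`exists_relation_of_line_over_T`, the relation
`[u] - [v]` on the line spread over `T`); `pr₁^*V₊(ν) · [W♯] = [closure ι(p)] + (vertical)`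
(`exists_primeInter_pullbackFormDivisor_line_eq_of_linear`) — this is `H_X · f_*(1)`;
`pr₁^*V₊(F) ∼ 3 pr₁^*V₊(ν)` so `pr₁^*V₊(F) · [W♯] ≡ 3 pr₁^*V₊(ν) · [W♯]` in `Rat₂(W♯)`
(Fulton Def. 2.3 / Prop. 2.3 (b)), pushed into `X ⊇ pr₁(W♯)`; and
`(pr₁₊(pr₁^*V₊(F) · [W♯]))|_X ≡ a · [X ∩ M]` (`exists_restrictMapFst_primeInter_sub_mem`).
[cite: Mboro2018, proof of Thm. 1.2, Case 1 (arXiv:1701.04488, p. 7)] [cite: Fulton1998, Def. 2.3, Prop. 2.3 (b), (c), Cor. 2.4.1] [cite: TianZong2014, Prop. 7.2 (proof)] -/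
theorem exists_relation_of_line_in_X_over_T (hd : 14 ≤ d)
    (hF : F ∈ grading (Fin (d + 1 + 1)) k 3) (hprime : Prime F)
    (hrange : Set.range i.left.base =
      ProjectiveSpectrum.zeroLocus (homogeneousSubmodule (Fin (d + 1 + 1)) k) {F})
    (hT2 : height (genericPoint T.left) = 2)
    {c : ℕ} (hdim : 2 + c = d) (ℓ : Fin c → MvPolynomial (Fin (d + 1 + 1)) k)
    (hℓ : ∀ j, ℓ j ∈ grading (Fin (d + 1 + 1)) k 1) (hlin : LinearIndependent k ℓ)
    (hav : ∀ j, (formDivisor (ℓ j) (hℓ j) (hlin.ne_zero j)).Avoids (i.left.base (genericPoint ↥X.left)))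
    (w : ↥(projectiveSpace (d + 1) k).left)
    (hw : (ProjectiveSpectrum.asHomogeneousIdeal
      (𝒜 := homogeneousSubmodule (Fin (d + 1 + 1)) k) w).toIdeal = Ideal.span (Set.range ℓ))
    (hFw : F ∉ ProjectiveSpectrum.asHomogeneousIdeal (𝒜 := homogeneousSubmodule (Fin (d + 1 + 1)) k) w)
    (f : T ⟶ projectiveSpace ((d + 1) * (d + 1) + 2 * (d + 1)) k)
    (x y : Fin (d + 1 + 1) → T.left.functionField)
    (hxy : LinearIndependent T.left.functionField ![x, y])
    (hFline : ∀ s t : T.left.functionField,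
      eval (s • x + t • y) (MvPolynomial.map (algebraMap k T.left.functionField) F) = 0)
    (P : Fin ((d + 1) * (d + 1) + 2 * (d + 1) + 1) → T.left.functionField)
    (hPw : ∀ a b, P (plIdx (d + 1) (a, b)) = wedge x y a b) (hP0 : P ≠ 0)
    (hP : qgen T ≫ f.left = (pointOfVec k P hP0).left) :
    ∃ (a : ℤ) (Pl : AlgebraicCycle X.left ℤ), (∀ y', Pl y' ≠ 0 → IsLinearSubspacePoint 2 (d + 1) i y') ∧
      3 • restrictMapFst T X i (primeCycle (genericFibreι (d + 1) T
          (pointOfVec T.left.functionField x (by simpa using hxy.ne_zero 0)).pt)) -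
        a • CartierDivisor.iterInter c
          (fun j => (formDivisor (ℓ j) (hℓ j) (hlin.ne_zero j)).pullbackAvoiding i.left (hav j))
          (primeCycle (genericPoint ↥X.left)) - Pl ∈ ratTrivial X.left 2 := by
  classical
  haveI := infinite_functionField (k := k) T
  haveI : IsProper (projectiveSpace (d + 1) k).hom := isProper_projectiveSpace (d + 1) k
  haveI : IsProper X.hom := by rw [← Over.w i]; infer_instance
  haveI : LocallyOfFiniteType (X ⊗ T).hom :=
    inferInstanceAs (LocallyOfFiniteType (pullback.fst X.hom T.hom ≫ X.hom))
  have hN : 1 ≤ d + 1 := by omega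
  have hF0 : F ≠ 0 := hprime.ne_zero
  have hF3 : F.IsHomogeneous 3 := (mem_homogeneousSubmodule 3 F).1 hF
  have hx0 : x ≠ 0 := by simpa using hxy.ne_zero 0
  have hpair := LinearIndependent.pair_iff.1 hxy
  -- notation
  let K := T.left.functionField
  let ι := genericFibreι (d + 1) T
  let fstP := (CartesianMonoidalCategory.fst (projectiveSpace (d + 1) k) T).left
  let R := restrictMapFst T X i
  let M : AlgebraicCycle (X ⊗ T).left ℤ → AlgebraicCycle X.left ℤ :=
    AlgebraicCycle.map (CartesianMonoidalCategory.fst X T).left height height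
  -- a coordinate hyperplane `V₊(ν)`, `ν = X_{j₀}`, with `ν(x) ≠ 0`, and the point `p = l ∩ V₊(ν)`
  obtain ⟨j₀, hj₀⟩ := Function.ne_iff.mp hx0
  let ν : MvPolynomial (Fin (d + 1 + 1)) k := MvPolynomial.X j₀
  have hν : ν ∈ grading (Fin (d + 1 + 1)) k 1 := X_mem k j₀
  have hν0 : ν ≠ 0 := MvPolynomial.X_ne_zero j₀
  have hνK : MvPolynomial.map (algebraMap k T.left.functionField) ν = MvPolynomial.X j₀ := map_X _ _
  have hνhom : (MvPolynomial.map (algebraMap k T.left.functionField) ν).IsHomogeneous 1 := by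
    rw [hνK]; exact isHomogeneous_X _ _
  have hνx : eval x (MvPolynomial.map (algebraMap k T.left.functionField) ν) ≠ 0 := by
    rw [hνK, eval_X]; exact hj₀
  let p : Fin (d + 1 + 1) → T.left.functionField :=
    eval y (MvPolynomial.map (algebraMap k T.left.functionField) ν) • x +
      (-eval x (MvPolynomial.map (algebraMap k T.left.functionField) ν)) • y
  have hνp : eval p (MvPolynomial.map (algebraMap k T.left.functionField) ν) = 0 := by
    change eval (_ • x + _ • y) _ = 0
    rw [eval_add_smul_of_isHomogeneous_one hνhom]
    ring
  have hp0 : p ≠ 0 := by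
    intro h
    have h2 := (hpair _ _ h).2
    exact hνx (neg_eq_zero.1 h2)
  -- the pair `x, p`
  have hlin_xp : ∀ s t : T.left.functionField, s • x + t • p =
      (s + t * eval y (MvPolynomial.map (algebraMap k T.left.functionField) ν)) • x +
        (-(t * eval x (MvPolynomial.map (algebraMap k T.left.functionField) ν))) • y := by
    intro s t
    ext j
    simp only [p, Pi.add_apply, Pi.smul_apply, smul_eq_mul]
    ring
  have hv : LinearIndependent T.left.functionField ![x, p] := by
    refine LinearIndependent.pair_iff.2 fun s t hst => ?_
    rw [hlin_xp] at hst
    obtain ⟨h1, h2⟩ := hpair _ _ hst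
    have ht : t = 0 := by
      rcases mul_eq_zero.1 (neg_eq_zero.1 h2) with h | h
      · exact h
      · exact absurd h hνx
    refine ⟨?_, ht⟩
    rw [ht, zero_mul, add_zero] at h1
    exact h1
  have hFv : ∀ s t : T.left.functionField,
      eval (s • x + t • p) (MvPolynomial.map (algebraMap k T.left.functionField) F) = 0 := by
    intro s t
    rw [hlin_xp]
    exact hFline _ _
  -- Plücker data of the pair `x, p`
  let P' : Fin ((d + 1) * (d + 1) + 2 * (d + 1) + 1) → T.left.functionField :=
    (-eval x (MvPolynomial.map (algebraMap k T.left.functionField) ν)) • P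
  have hP'w : ∀ a b, P' (plIdx (d + 1) (a, b)) = wedge x p a b := by
    intro a b
    change (-eval x _) * P (plIdx (d + 1) (a, b)) = wedge x (_ • x + _ • y) a b
    rw [wedge_self_add_smul, hPw]
    rfl
  have hc0 : -eval x (MvPolynomial.map (algebraMap k T.left.functionField) ν) ≠ 0 := neg_ne_zero.2 hνx
  have hP'0 : P' ≠ 0 := smul_ne_zero hc0 hP0
  have hP' : qgen T ≫ f.left = (pointOfVec k P' hP'0).left := by
    rw [hP]
    exact congrArg CommaMorphism.left (pointOfVec_smul (k := k) P hP0 _ hc0 hP'0).symm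
  -- (1) the two sections `[x]`, `p` differ by planes
  obtain ⟨c', hc', uX, huX, Pl₁, hPl₁, hE⟩ := exists_relation_of_line_over_T T X i hd hF3 hrange hT2 f
    ![x, p] hv hFv P' hP'w hP'0 hP'
  have hMc' : M c' ∈ ratTrivial X.left 2 :=
    map_mem_ratTrivial_holds (d := 2) (CartesianMonoidalCategory.fst X T) hc'
  have hjι : ∀ q, (i ▷ T).left.base ((ιX T X).base q) = ι ((iK (d + 1) T X i).base q) := by
    intro q
    change ((ιX T X ≫ (i ▷ T).left).base q) = ((iK (d + 1) T X i ≫ genericFibreι (d + 1) T).base q)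
    rw [iK_genericFibreι]
  have hMu : ∀ a, M (primeCycle ((ιX T X).base (uX a))) =
      R (primeCycle (ι (pointOfVec T.left.functionField (![x, p] a) (hv.ne_zero a)).pt)) := by
    intro a
    rw [← huX a, ← hjι]
    exact (restrictMapFst_primeCycle_whiskerRight T X i _).symm
  have hE1 : R (primeCycle (ι (pointOfVec T.left.functionField x hx0).pt)) -
      R (primeCycle (ι (pointOfVec T.left.functionField p hp0).pt)) + Pl₁ ∈ ratTrivial X.left 2 := by
    have h0 : M (primeCycle ((ιX T X).base (uX 0))) = R (primeCycle (ι (pointOfVec T.left.functionField x hx0).pt)) :=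
      hMu 0
    have h1 : M (primeCycle ((ιX T X).base (uX 1))) = R (primeCycle (ι (pointOfVec T.left.functionField p hp0).pt)) :=
      hMu 1
    have key : R (primeCycle (ι (pointOfVec T.left.functionField x hx0).pt)) -
        R (primeCycle (ι (pointOfVec T.left.functionField p hp0).pt)) + Pl₁ =
        M c' - (M c' - (M (primeCycle ((ιX T X).base (uX 0))) - M (primeCycle ((ιX T X).base (uX 1)))) - Pl₁) := by
      rw [h0, h1]; abel
    rw [key]
    exact AddSubgroup.sub_mem _ hMc' hE
  -- the line forms of `l = span(x, y)`
  obtain ⟨μ, hμli, hμhom, hμv, hμideal⟩ := exists_lineForms ![x, y] hxy hN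
  have hμx : ∀ l, eval x (μ l) = 0 := fun l => hμv l 0
  have hμy : ∀ l, eval y (μ l) = 0 := fun l => hμv l 1
  have hμideal' : ∀ G : MvPolynomial (Fin (d + 1 + 1)) T.left.functionField,
      (∀ s t : T.left.functionField, eval (s • x + t • y) G = 0) → G ∈ Ideal.span (Set.range μ) :=
    fun G hG => hμideal G fun s t => hG s t
  have hμp : ∀ l, eval p (μ l) = 0 := by
    intro l
    change eval (_ • x + _ • y) _ = 0
    rw [eval_add_smul_of_isHomogeneous_one (hμhom l), hμx, hμy, mul_zero, mul_zero, add_zero]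
  let lam : ↥(projectiveSpace (d + 1) T.left.functionField).left :=
    linearSubspacePoint μ hμli hμhom (Nat.sub_le (d + 1) 1)
  have hlam1 : height lam = 1 := height_linearSubspacePoint_of_line hN μ hμli hμhom
  have hιlam : height (ι lam) = (2 : ℕ) + 1 := by
    change height (genericFibreι (d + 1) T lam) = _
    rw [height_genericFibreι_apply (d + 1) T hT2, hlam1]
  -- `F ⊗ 1 ∈ 𝔭_l`: the line lies on `X`, so `closure ι(l) ⊆ pr₁⁻¹(X)`
  have hFlam : MvPolynomial.map (algebraMap k T.left.functionField) F ∈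
      ProjectiveSpectrum.asHomogeneousIdeal
        (𝒜 := homogeneousSubmodule (Fin (d + 1 + 1)) T.left.functionField) lam := by
    change _ ∈ (ProjectiveSpectrum.asHomogeneousIdeal
      (𝒜 := homogeneousSubmodule (Fin (d + 1 + 1)) T.left.functionField) lam).toIdeal
    rw [toIdeal_linearSubspacePoint]
    exact hμideal' _ hFline
  have hw₀X : fstP.base (ι lam) ∈ Set.range i.left.base := by
    rw [hrange]
    intro G hG
    rw [Set.mem_singleton_iff.mp hG]
    change F ∈ ProjectiveSpectrum.asHomogeneousIdeal (𝒜 := homogeneousSubmodule (Fin (d + 1 + 1)) k)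
      ((CartesianMonoidalCategory.fst (projectiveSpace (d + 1) k) T).left (genericFibreι (d + 1) T lam))
    rw [fst_genericFibreι_apply, mem_asHomogeneousIdeal_projMap_iff]
    exact hFlam
  have hclX : closure {ι lam} ⊆ fstP.base ⁻¹' Set.range i.left.base :=
    closure_minimal (Set.singleton_subset_iff.2 hw₀X)
      ((i.left.isClosedEmbedding.isClosed_range).preimage fstP.continuous)
  have hZT : fstP.base '' closure {ι lam} ⊆ Set.range i.left.base := by
    rintro _ ⟨w', hw', rfl⟩
    exact hclX hw'
  -- (2) `pr₁^*V₊(ν) · [closure ι(l)] = [closure ι(p)] + V'`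
  obtain ⟨V', hZ', -, hV'supp⟩ := exists_primeInter_pullbackFormDivisor_line_eq_of_linear (B := T) hN
    hT2 (x := p) (y := x) hp0 hν hν0 hνp hνx hμli hμhom hμp hμx
  -- (3) the vertical part of it pushes forward to planes
  obtain ⟨Pl₂, hPl₂, hRV'⟩ := exists_planes_restrictMapFst_of_vertical T X i hd hF3 hrange hT2 f x y P hPw
    hP0 hP hμli hμhom hμideal' V' fun w' hw' => by
      obtain ⟨hsp, hh2, hη, -⟩ := hV'supp w' hw'
      refine ⟨hsp, hh2, hη, ?_⟩
      have hmem : fstP.base w' ∈ Set.range i.left.base := hclX (specializes_iff_mem_closure.mp hsp)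
      rw [hrange] at hmem
      exact hmem (Set.mem_singleton F)
  -- (4) `(pr₁₊(pr₁^*V₊(F) · [closure ι(l)]))|_X ≡ a · [X ∩ M]`
  obtain ⟨a, ha⟩ := exists_restrictMapFst_primeInter_sub_mem T X i hF hprime hrange hdim ℓ hℓ hlin hav
    w hw hFw hιlam
  -- (5) `pr₁^*V₊(F) · [W♯] ≡ 3 pr₁^*V₊(ν) · [W♯]` modulo `Rat₂(ℙᵈ⁺¹ ×ₖ T; W♯)`
  have hνav := formDivisor_avoids_fst_genericPoint (B := T) hν hν0
  have hFav := formDivisor_avoids_fst_genericPoint (B := T) hF hF0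
  -- on `ℙᵈ⁺¹_k`: `V₊(F) ∼ V₊(ν) + V₊(ν) + V₊(ν)`
  have h1 : ((1 : ℕ) • hyperplane (d + 1) k).LinEquiv (formDivisor ν hν hν0) := by
    rw [CartierDivisor.one_smul]; exact hyperplane_linEquiv_formDivisor hν hν0
  have hlinP : (formDivisor F hF hF0).LinEquiv
      (formDivisor ν hν hν0 + formDivisor ν hν hν0 + formDivisor ν hν hν0) := by
    have h3 : (formDivisor F hF hF0).LinEquiv (3 • hyperplane (d + 1) k) :=
      (smul_hyperplane_linEquiv_formDivisor hF hF0).symm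
    have h21 : (3 • hyperplane (d + 1) k).LinEquiv
        (2 • hyperplane (d + 1) k + (1 : ℕ) • hyperplane (d + 1) k) :=
      (CartierDivisor.add_smul_sameDivisor (hyperplane (d + 1) k) 2 1).linEquiv
    have h11 : (2 • hyperplane (d + 1) k + (1 : ℕ) • hyperplane (d + 1) k).LinEquiv
        ((1 : ℕ) • hyperplane (d + 1) k + (1 : ℕ) • hyperplane (d + 1) k + (1 : ℕ) • hyperplane (d + 1) k) :=
      (CartierDivisor.add_smul_sameDivisor (hyperplane (d + 1) k) 1 1).linEquiv.add (CartierDivisor.LinEquiv.refl _)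
    exact ((h3.trans h21).trans h11).trans ((h1.add h1).add h1)
  -- pulled back along `pr₁`
  have hlinT : (pullbackFormDivisor (B := T) hF hF0).LinEquiv
      (pullbackFormDivisor (B := T) hν hν0 + pullbackFormDivisor (B := T) hν hν0 +
        pullbackFormDivisor (B := T) hν hν0) := by
    have h := hlinP.pullbackAvoiding fstP hFav ((hνav.add hνav).add hνav)
    refine h.trans ?_
    refine (CartierDivisor.pullbackAvoiding_add_sameDivisor fstP (hνav.add hνav) hνav).linEquiv.trans ?_
    exact (CartierDivisor.pullbackAvoiding_add_sameDivisor fstP hνav hνav).linEquiv.add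
      (CartierDivisor.LinEquiv.refl _)
  have hνlam : MvPolynomial.map (algebraMap k T.left.functionField) ν ∉
      ProjectiveSpectrum.asHomogeneousIdeal
        (𝒜 := homogeneousSubmodule (Fin (d + 1 + 1)) T.left.functionField) lam :=
    notMem_asHomogeneousIdeal_linearSubspacePoint_of_eval_ne_zero hμli hμhom hμx hνx
  have havν : (pullbackFormDivisor (B := T) hν hν0).Avoids (ι lam) :=
    (pullbackFormDivisor_avoids_genericFibreι_iff hν hν0 one_pos lam).2 hνlam
  have hL : (pullbackFormDivisor (B := T) hF hF0).primeInter (X := (projectiveSpace (d + 1) k) ⊗ T) (ι lam) -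
      ((pullbackFormDivisor (B := T) hν hν0).primeInter (X := (projectiveSpace (d + 1) k) ⊗ T) (ι lam) +
        (pullbackFormDivisor (B := T) hν hν0).primeInter (X := (projectiveSpace (d + 1) k) ⊗ T) (ι lam) +
        (pullbackFormDivisor (B := T) hν hν0).primeInter (X := (projectiveSpace (d + 1) k) ⊗ T) (ι lam)) ∈
      ratTrivialOn ((projectiveSpace (d + 1) k) ⊗ T).left (closure {ι lam}) 2 := by
    have h := hlinT.primeInter_sub_primeInter_mem (X := (projectiveSpace (d + 1) k) ⊗ T) hιlam
    rwa [CartierDivisor.primeInter_add (havν.add havν) havν, CartierDivisor.primeInter_add havν havν] at h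
  have hLX : R ((pullbackFormDivisor (B := T) hF hF0).primeInter (X := (projectiveSpace (d + 1) k) ⊗ T) (ι lam)) -
      (R ((pullbackFormDivisor (B := T) hν hν0).primeInter (X := (projectiveSpace (d + 1) k) ⊗ T) (ι lam)) +
        R ((pullbackFormDivisor (B := T) hν hν0).primeInter (X := (projectiveSpace (d + 1) k) ⊗ T) (ι lam)) +
        R ((pullbackFormDivisor (B := T) hν hν0).primeInter (X := (projectiveSpace (d + 1) k) ⊗ T) (ι lam))) ∈
      ratTrivial X.left 2 := by
    have h := cycleRestrictClosed_mem_ratTrivial_of_mem_ratTrivialOn i.left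
      (map_mem_ratTrivialOn_of_image_subset (CartesianMonoidalCategory.fst (projectiveSpace (d + 1) k) T)
        hZT hL)
    rw [← map_add, ← map_add, ← map_sub]
    exact h
  -- (6) assemble, with the plane cycle `-(3 Pl₁ + 3 Pl₂)`
  refine ⟨a, -(3 • Pl₁ + 3 • Pl₂), fun y' hy' => ?_, ?_⟩
  · rw [Function.locallyFinsuppWithin.coe_neg, Pi.neg_apply, neg_ne_zero,
      Function.locallyFinsuppWithin.coe_add, Pi.add_apply] at hy'
    by_cases h1y : Pl₁ y' = 0
    · refine hPl₂ y' fun h2y => hy' ?_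
      rw [Function.locallyFinsuppWithin.coe_nsmul, Function.locallyFinsuppWithin.coe_nsmul, Pi.smul_apply,
        Pi.smul_apply, h1y, h2y, nsmul_zero, add_zero]
    · exact hPl₁ y' h1y
  · have hRH : R ((pullbackFormDivisor (B := T) hν hν0).primeInter (X := (projectiveSpace (d + 1) k) ⊗ T)
        (ι lam)) = R (primeCycle (ι (pointOfVec T.left.functionField p hp0).pt)) + R V' := by
      change R ((pullbackFormDivisor (B := T) hν hν0).primeInter (X := (projectiveSpace (d + 1) k) ⊗ T)
        (genericFibreι (d + 1) T lam)) = _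
      rw [hZ', map_add]
    rw [hRH] at hLX
    have key : 3 • R (primeCycle (ι (pointOfVec T.left.functionField x (by simpa using hxy.ne_zero 0)).pt)) -
        a • CartierDivisor.iterInter c
          (fun j => (formDivisor (ℓ j) (hℓ j) (hlin.ne_zero j)).pullbackAvoiding i.left (hav j))
          (primeCycle (genericPoint ↥X.left)) - -(3 • Pl₁ + 3 • Pl₂) =
        3 • (R (primeCycle (ι (pointOfVec T.left.functionField x hx0).pt)) -
          R (primeCycle (ι (pointOfVec T.left.functionField p hp0).pt)) + Pl₁) -
        (R ((pullbackFormDivisor (B := T) hF hF0).primeInter (X := (projectiveSpace (d + 1) k) ⊗ T) (ι lam)) -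
          (R (primeCycle (ι (pointOfVec T.left.functionField p hp0).pt)) + R V' +
            (R (primeCycle (ι (pointOfVec T.left.functionField p hp0).pt)) + R V') +
            (R (primeCycle (ι (pointOfVec T.left.functionField p hp0).pt)) + R V'))) -
        3 • (R V' - Pl₂) +
        (R ((pullbackFormDivisor (B := T) hF hF0).primeInter (X := (projectiveSpace (d + 1) k) ⊗ T) (ι lam)) -
          a • CartierDivisor.iterInter c
            (fun j => (formDivisor (ℓ j) (hℓ j) (hlin.ne_zero j)).pullbackAvoiding i.left (hav j))
            (primeCycle (genericPoint ↥X.left))) := by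
      abel
    rw [key]
    refine AddSubgroup.add_mem _ (AddSubgroup.sub_mem _ (AddSubgroup.sub_mem _
      (AddSubgroup.nsmul_mem _ hE1 3) hLX) (AddSubgroup.nsmul_mem _ hRV' 3)) ha

end Relation

end ProjFamily

end Literature.AlgebraicGeometry.Motives
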